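import Literature.AlgebraicGeometry.Resolution.AlterationsDegreeOne
import HarnessLib

/-!
# Degrees of alterations in towers: `deg (ψ ≫ φ) = deg ψ · deg φ`

Topic `Literature/AlgebraicGeometry/Resolution`; companion of `Alterations.lean` (`IsAlteration`,
`IsAlteration.comp` in `AlterationsProofs.lean` — de Jong 1996, 2.20: "A composition of alterations
is an alteration"), `GabberTemkinAlterations.lean` (`IsAlteration.degree = [K(X₁) : K(X)]`,
`IsAlteration.IsSeparable`, the named facts `GabberPrimeToEllAlteration`, `Temkin2017PAlteration`)
and `AlterationsDegreeOne.lean` (`deg φ = 1 ⟺ φ` birational). Everything here is PROVED (no named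
facts): for alterations `ψ : X'' → X'` and `φ : X' → X` of an integral scheme `X`,

  `deg (ψ ≫ φ) = deg ψ · deg φ`                      (`IsAlteration.degree_comp`),

the tower law `[K(X'') : K(X)] = [K(X'') : K(X')] · [K(X') : K(X)]` for the function fields along
`(ψ ≫ φ)^♯ = ψ^♯ ∘ φ^♯` (`Motives.RatFn.functionFieldMap_comp`), together with its consequences
for the DEGREE CLASSES in which the degree-controlled alteration theorems are stated (Temkin 2017,
§1.2.1: "We say that `n ∈ ℕ` is a `𝒫`-number if all its prime divisors lie in `𝒫`. By a
`𝒫`-alteration we mean an alteration whose degree is a `𝒫`-number"; §2.1.1: "for a tower of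
finite extensions `F/L/K`, the degree `[F:K] = [F:L][L:K]` is a `𝒫`-number if and only if both
`[F:L]` and `[L:K]` are `𝒫`-numbers"):

* `IsAlteration.forall_prime_dvd_degree_comp_iff` — a composite of alterations is a
  `𝒫`-alteration iff both factors are (Temkin 2017, §2.1.1, verbatim in prime-divisor form);
* `IsAlteration.coprime_degree_comp_iff` — `ℓ ∤ deg (ψ ≫ φ)` iff `ℓ ∤ deg ψ` and `ℓ ∤ deg φ`
  (`ℓ` prime): Gabber's `ℓ'`-alterations (Illusie–Laszlo–Orgogozo 2014, Exp. X §2; the degree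
  class of `GabberPrimeToEllAlteration`) are closed under composition and under passing to the
  factors of a composite;
* `IsAlteration.exists_degree_comp_eq_pow_iff` — `deg (ψ ≫ φ)` is a power of the prime `p` iff
  both `deg ψ` and `deg φ` are (the degree class of `Temkin2017PAlteration` in characteristic `p`);
* `IsAlteration.degree_comp_eq_one_iff`, `IsAlteration.isBirational_comp_iff` — a composite of
  alterations has degree `1`, equivalently (`AlterationsDegreeOne.lean`) is birational, iff every
  factor is: the "degree `1`" door of `hasResolution_iff_exists_isAlteration_degree_eq_one` is not
  reached by composing alterations of degree `> 1`;
* `IsAlteration.isSeparable_comp_iff` — a composite of alterations is separable (de Jong 1996,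
  2.20: generically étale iff `R(S) ⊂ R(S')` separable; Illusie–Laszlo–Orgogozo 2014, Exp. X 3.3.1)
  iff both factors are (separability in towers).

These are the bookkeeping rules by which the `ResolutionOfSingularities` campaign (D-0089, rung L,
route "degree → 1") prices COMPOSITE alterations — e.g. de Jong's Galois alteration
(`DeJong1997_galoisAlteration`: a quotient map followed by a radicial one) or an `ℓ'`-alteration
followed by a `char(X)`-alteration — from the degrees of their factors. No new definition is
introduced: "`𝒫`-number" is spelled out as "every prime divisor lies in `𝒫`", exactly as in
`Temkin2017PAlteration`.

## Sources (texts in hand, read 2026-08-26)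

* M. Temkin, *Tame distillation and desingularization by p-alterations*, Ann. of Math. 186 (2017)
  = arXiv:1508.06255v2: §1.1.2 ("the degree `[k(X') : k(X)]` of the alteration"), §1.2.1
  (`𝒫`-numbers, `𝒫`-alterations; p. 2), §2.1.1 (`𝒫`-extensions are transitive: "for a tower of
  finite extensions `F/L/K`, the degree `[F:K] = [F:L][L:K]` is a `𝒫`-number if and only if both
  `[F:L]` and `[L:K]` are `𝒫`-numbers"; held text `paper:arxiv-1508.06255` chunk p0006 l. 11).
  [Temkin2017]
* A. J. de Jong, *Smoothness, semi-stability and alterations*, Publ. Math. IHÉS 83 (1996), 2.20,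
  p. 61 (held `doi:10.1007/bf02698644`, PDF p. 12 l. 7–16: "A composition of alterations is an
  alteration. … an alteration `S' → S` is generically étale if and only if the (finite) extension
  of function fields `R(S) ⊂ R(S')` is separable"). [DeJong1996]
* L. Illusie, Y. Laszlo, F. Orgogozo (eds.), Astérisque 363–364 (2014), Exp. X §2 (`ℓ'`-alteration:
  degree prime to `ℓ`) and 3.3.1 (separable alteration), arXiv:1207.3648v1 pp. 148–149, 158 — as
  quoted in `GabberTemkinAlterations.lean`. [IllusieLaszloOrgogozo2014]
* Tower law and separability in towers: Mathlib (`Module.finrank_mul_finrank`,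
  `Algebra.IsSeparable.trans`, `Algebra.isSeparable_tower_top_of_isSeparable`,
  `Algebra.isSeparable_tower_bot_of_isSeparable`). [folklore]
-/

noncomputable section

open CategoryTheory AlgebraicGeometry TopologicalSpace

namespace Literature.AlgebraicGeometry.Resolution

universe u

open Literature.AlgebraicGeometry.Motives Literature.AlgebraicGeometry.Motives.RatFn

namespace IsAlteration

variable {X'' X' X : Scheme.{u}} [IsIntegral X] [IsIntegral X'] {ψ : X'' ⟶ X'} {φ : X' ⟶ X}

/-! ## The tower law -/

/-- **Degrees of alterations multiply in towers**: for alterations `ψ : X'' → X'` and `φ : X' → X`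
of an integral scheme, `deg (ψ ≫ φ) = deg ψ · deg φ`, i.e.
`[K(X'') : K(X)] = [K(X'') : K(X')] · [K(X') : K(X)]` along `(ψ ≫ φ)^♯ = ψ^♯ ∘ φ^♯` (Temkin 2017,
§2.1.1: "for a tower of finite extensions `F/L/K`, the degree `[F:K] = [F:L][L:K]`"; the composite
is an alteration by de Jong 1996, 2.20). Proof: make `K(X'')` an algebra over `K(X')` through
`ψ^♯`; `functionFieldMap_comp` says the three function fields form a scalar tower, and Mathlib's
`Module.finrank_mul_finrank` is the tower law.
[cite: Temkin2017, §2.1.1 (arXiv:1508.06255v2)] [cite: DeJong1996, 2.20, p. 61] -/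
theorem degree_comp (hψ : IsAlteration ψ) (hφ : IsAlteration φ) :
    (hψ.comp hφ).degree = hψ.degree * hφ.degree := by
  haveI : IsIntegral X'' := hψ.isIntegral
  haveI : IsDominant φ := hφ.isDominant
  haveI : IsDominant ψ := hψ.isDominant
  haveI : IsDominant (ψ ≫ φ) := (hψ.comp hφ).isDominant
  letI alg : Algebra (FunctionFieldOver φ) (FunctionFieldOver (ψ ≫ φ)) :=
    (functionFieldMap ψ : X'.functionField →+* X''.functionField).toAlgebra
  haveI : IsScalarTower X.functionField (FunctionFieldOver φ) (FunctionFieldOver (ψ ≫ φ)) :=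
    IsScalarTower.of_algebraMap_eq' (functionFieldMap_comp φ ψ)
  rw [(hψ.comp hφ).degree_eq_finrank, hφ.degree_eq_finrank, hψ.degree_eq_finrank, mul_comm,
    ← Module.finrank_mul_finrank X.functionField (FunctionFieldOver φ) (FunctionFieldOver (ψ ≫ φ))]
  rfl

/-- The degree of the lower alteration divides the degree of the composite
(`deg φ ∣ deg (ψ ≫ φ)`). [cite: Temkin2017, §2.1.1 (arXiv:1508.06255v2)] -/
theorem degree_dvd_degree_comp_right (hψ : IsAlteration ψ) (hφ : IsAlteration φ) :
    hφ.degree ∣ (hψ.comp hφ).degree :=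
  ⟨hψ.degree, by rw [degree_comp hψ hφ, mul_comm]⟩

/-- The degree of the upper alteration divides the degree of the composite
(`deg ψ ∣ deg (ψ ≫ φ)`). [cite: Temkin2017, §2.1.1 (arXiv:1508.06255v2)] -/
theorem degree_dvd_degree_comp_left (hψ : IsAlteration ψ) (hφ : IsAlteration φ) :
    hψ.degree ∣ (hψ.comp hφ).degree :=
  ⟨hφ.degree, by rw [degree_comp hψ hφ]⟩

/-- `deg φ ≤ deg (ψ ≫ φ)`: the tower law `[F:K] = [F:L][L:K]` with `[F:L] ≥ 1` (degrees of
alterations are positive, `degree_pos`). [cite: Temkin2017, §2.1.1 (arXiv:1508.06255v2)] -/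
theorem degree_le_degree_comp_right (hψ : IsAlteration ψ) (hφ : IsAlteration φ) :
    hφ.degree ≤ (hψ.comp hφ).degree :=
  Nat.le_of_dvd (hψ.comp hφ).degree_pos (degree_dvd_degree_comp_right hψ hφ)

/-- `deg ψ ≤ deg (ψ ≫ φ)`: the tower law `[F:K] = [F:L][L:K]` with `[L:K] ≥ 1` (degrees of
alterations are positive, `degree_pos`). [cite: Temkin2017, §2.1.1 (arXiv:1508.06255v2)] -/
theorem degree_le_degree_comp_left (hψ : IsAlteration ψ) (hφ : IsAlteration φ) :
    hψ.degree ≤ (hψ.comp hφ).degree :=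
  Nat.le_of_dvd (hψ.comp hφ).degree_pos (degree_dvd_degree_comp_left hψ hφ)

/-! ## Degree classes are multiplicative (Temkin 2017, §2.1.1) -/

/-- **A prime divides the degree of a composite of alterations iff it divides the degree of one of
the factors** (`deg (ψ ≫ φ) = deg ψ · deg φ` and Euclid's lemma).
[cite: Temkin2017, §2.1.1 (arXiv:1508.06255v2)] -/
theorem prime_dvd_degree_comp_iff (hψ : IsAlteration ψ) (hφ : IsAlteration φ) {q : ℕ}
    (hq : q.Prime) : q ∣ (hψ.comp hφ).degree ↔ q ∣ hψ.degree ∨ q ∣ hφ.degree := by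
  rw [degree_comp hψ hφ]
  exact hq.dvd_mul

/-- **`𝒫`-alterations are closed under composition and under passing to factors** (Temkin 2017,
§1.2.1: "`n ∈ ℕ` is a `𝒫`-number if all its prime divisors lie in `𝒫` … a `𝒫`-alteration [is]
an alteration whose degree is a `𝒫`-number"; §2.1.1: "`[F:K] = [F:L][L:K]` is a `𝒫`-number if
and only if both `[F:L]` and `[L:K]` are `𝒫`-numbers"): for a set of primes `P`, every prime
divisor of `deg (ψ ≫ φ)` lies in `P` iff the same holds for `deg ψ` and for `deg φ`. With
`P = char(X)` this is the degree class of `Temkin2017PAlteration`; with `P = {ℓ}ᶜ` that of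
`GabberPrimeToEllAlteration`. [cite: Temkin2017, §1.2.1 (p. 2) and §2.1.1 (arXiv:1508.06255v2)] -/
theorem forall_prime_dvd_degree_comp_iff (hψ : IsAlteration ψ) (hφ : IsAlteration φ)
    (P : Set ℕ) :
    (∀ q : ℕ, q.Prime → q ∣ (hψ.comp hφ).degree → q ∈ P) ↔
      (∀ q : ℕ, q.Prime → q ∣ hψ.degree → q ∈ P) ∧ (∀ q : ℕ, q.Prime → q ∣ hφ.degree → q ∈ P) := by
  constructor
  · intro h
    exact ⟨fun q hq hd => h q hq ((prime_dvd_degree_comp_iff hψ hφ hq).mpr (Or.inl hd)),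
      fun q hq hd => h q hq ((prime_dvd_degree_comp_iff hψ hφ hq).mpr (Or.inr hd))⟩
  · rintro ⟨h₁, h₂⟩ q hq hd
    rcases (prime_dvd_degree_comp_iff hψ hφ hq).mp hd with hd | hd
    · exact h₁ q hq hd
    · exact h₂ q hq hd

/-- **`ℓ'`-alterations compose** (the degree class of Gabber's theorem, Illusie–Laszlo–Orgogozo
2014, Exp. X §2: degree prime to `ℓ`): `deg (ψ ≫ φ)` is prime to `ℓ` iff both `deg ψ` and `deg φ`
are. [cite: IllusieLaszloOrgogozo2014, Exp. X §2 (arXiv:1207.3648v1 p. 148)]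
[cite: Temkin2017, §2.1.1 (arXiv:1508.06255v2)] -/
theorem coprime_degree_comp_iff (hψ : IsAlteration ψ) (hφ : IsAlteration φ) {ℓ : ℕ} :
    Nat.Coprime ℓ (hψ.comp hφ).degree ↔ Nat.Coprime ℓ hψ.degree ∧ Nat.Coprime ℓ hφ.degree := by
  rw [degree_comp hψ hφ]
  exact Nat.coprime_mul_iff_right

/-- **`p`-power degrees compose** (the degree class of `Temkin2017PAlteration` over a field of
characteristic `p`, `Temkin2017PAlteration.exists_degree_eq_pow`): for a prime `p`, `deg (ψ ≫ φ)`
is a power of `p` iff both `deg ψ` and `deg φ` are.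
[cite: Temkin2017, §1.2.1 and §2.1.1 (arXiv:1508.06255v2)] -/
theorem exists_degree_comp_eq_pow_iff (hψ : IsAlteration ψ) (hφ : IsAlteration φ) {p : ℕ}
    (hp : p.Prime) :
    (∃ n : ℕ, (hψ.comp hφ).degree = p ^ n) ↔
      (∃ a : ℕ, hψ.degree = p ^ a) ∧ (∃ b : ℕ, hφ.degree = p ^ b) := by
  constructor
  · rintro ⟨n, hn⟩
    have h₁ : hψ.degree ∣ p ^ n := hn ▸ degree_dvd_degree_comp_left hψ hφ
    have h₂ : hφ.degree ∣ p ^ n := hn ▸ degree_dvd_degree_comp_right hψ hφ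
    obtain ⟨a, -, ha⟩ := (Nat.dvd_prime_pow hp).mp h₁
    obtain ⟨b, -, hb⟩ := (Nat.dvd_prime_pow hp).mp h₂
    exact ⟨⟨a, ha⟩, ⟨b, hb⟩⟩
  · rintro ⟨⟨a, ha⟩, ⟨b, hb⟩⟩
    exact ⟨a + b, by rw [degree_comp hψ hφ, ha, hb, pow_add]⟩

/-! ## Degree one and birationality of composites -/

/-- **A composite of alterations has degree `1` iff both factors have degree `1`.**
[cite: Temkin2017, §2.1.1 (arXiv:1508.06255v2)] -/
theorem degree_comp_eq_one_iff (hψ : IsAlteration ψ) (hφ : IsAlteration φ) :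
    (hψ.comp hφ).degree = 1 ↔ hψ.degree = 1 ∧ hφ.degree = 1 := by
  rw [degree_comp hψ hφ]
  constructor
  · intro h
    exact ⟨Nat.dvd_one.mp ⟨hφ.degree, h.symm⟩,
      Nat.dvd_one.mp ⟨hψ.degree, ((mul_comm _ _).trans h).symm⟩⟩
  · rintro ⟨h₁, h₂⟩
    rw [h₁, h₂]

/-- **A composite of alterations is birational iff every factor is** (with
`IsAlteration.degree_eq_one_iff_isBirational`: `deg = 1 ⟺` birational; Abramovich–Oort 2000,
Rem. 1.5: "A modification is a birational alteration"). In particular composing alterations of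
degree `> 1` never reaches the degree-`1` door of
`hasResolution_iff_exists_isAlteration_degree_eq_one`.
[cite: AbramovichOort2000, Remark 1.5 (arXiv:math/9806100 §1.2)] [cite: DeJong1996, 2.20, p. 61] -/
theorem isBirational_comp_iff (hψ : IsAlteration ψ) (hφ : IsAlteration φ) :
    IsBirational (ψ ≫ φ) ↔ IsBirational ψ ∧ IsBirational φ := by
  rw [← (hψ.comp hφ).degree_eq_one_iff_isBirational, ← hψ.degree_eq_one_iff_isBirational,
    ← hφ.degree_eq_one_iff_isBirational]
  exact degree_comp_eq_one_iff hψ hφ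

/-! ## Separability of composites -/

/-- **A composite of alterations is separable iff both factors are** (de Jong 1996, 2.20: an
alteration is generically étale iff the finite extension of function fields is separable;
Illusie–Laszlo–Orgogozo 2014, Exp. X 3.3.1; separability in the tower
`K(X) ⊂ K(X') ⊂ K(X'')`: Mathlib `Algebra.IsSeparable.trans`,
`Algebra.isSeparable_tower_top_of_isSeparable`, `Algebra.isSeparable_tower_bot_of_isSeparable`).
[cite: DeJong1996, 2.20, p. 61] [cite: IllusieLaszloOrgogozo2014, Exp. X 3.3.1 (arXiv:1207.3648v1 p. 158)] -/
theorem isSeparable_comp_iff (hψ : IsAlteration ψ) (hφ : IsAlteration φ) :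
    (hψ.comp hφ).IsSeparable ↔ hψ.IsSeparable ∧ hφ.IsSeparable := by
  haveI : IsIntegral X'' := hψ.isIntegral
  haveI : IsDominant φ := hφ.isDominant
  haveI : IsDominant ψ := hψ.isDominant
  haveI : IsDominant (ψ ≫ φ) := (hψ.comp hφ).isDominant
  letI alg : Algebra (FunctionFieldOver φ) (FunctionFieldOver (ψ ≫ φ)) :=
    (functionFieldMap ψ : X'.functionField →+* X''.functionField).toAlgebra
  haveI : IsScalarTower X.functionField (FunctionFieldOver φ) (FunctionFieldOver (ψ ≫ φ)) :=
    IsScalarTower.of_algebraMap_eq' (functionFieldMap_comp φ ψ)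
  -- the separability of `ψ` is that of the top storey of the tower (same extension, same map)
  have eψ : hψ.IsSeparable ↔ Algebra.IsSeparable (FunctionFieldOver φ) (FunctionFieldOver (ψ ≫ φ)) :=
    Iff.rfl
  rw [(hψ.comp hφ).isSeparable_iff, hφ.isSeparable_iff, eψ]
  constructor
  · intro h
    exact ⟨Algebra.isSeparable_tower_top_of_isSeparable X.functionField (FunctionFieldOver φ)
        (FunctionFieldOver (ψ ≫ φ)),
      Algebra.isSeparable_tower_bot_of_isSeparable X.functionField (FunctionFieldOver φ)
        (FunctionFieldOver (ψ ≫ φ))⟩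
  · rintro ⟨h₁, h₂⟩
    exact Algebra.IsSeparable.trans X.functionField (FunctionFieldOver φ) (FunctionFieldOver (ψ ≫ φ))

end IsAlteration

end Literature.AlgebraicGeometry.Resolution

end
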